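import Literature.Algebra.Lie.JordanLefschetzPrimGeneration
import HarnessLib

/-!
# Lefschetz triples and modules of Jordan type: `𝔤₄ = 0` makes `(𝔤, h)` Jordan–Lefschetz, and then `M = U𝔤₂ · Prim(M)` (Looijenga–Lunts 1997, (2.1)–(2.3))

Topic `Literature/Algebra/Lie` (namespace `Literature.Algebra.Lie`).  Lane `lit-hodgefound` (Track 2 foundations
library), skeleton seat `lit-hodgefound-skel-1` (generation 41), row **A1-109** of
`run/shared/lean/pub/lit-hodgefound/SKELETON.md`: the bridge between Lefschetz modules / triples (A1-84, A1-88,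
A1-101) and Jordan–Lefschetz pairs (A1-84 `IsJordanLefschetzPair`) that Looijenga–Lunts use implicitly when passing
from (2.1) to (2.2) ("the graded Lie algebra's that so arise"), together with (2.3) (A1-108) restated for Lefschetz
MODULES of Jordan type — the form in which it is used for the Lie algebras `𝔤_NS(X)`, `𝔤_tot(X)` of §3–§4.  PROVED
theorems only (no definition, no named fact, no `sorry`; D-0026 net debt `0`).  `LieRing.ofAssociativeRing` is
enabled FILE-LOCALLY as in the rest of the series.

## Source, VERBATIM

E. Looijenga, V. A. Lunts, *A Lie algebra attached to a projective variety*, Invent. Math. **129** (1997) 361–412,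
§2 (held text `paper:arxiv-alg-geom_9604014` p0009 L79–L83, L108–L125):

> "(2.1) Proposition. Let `M` be a Lefschetz `𝔞`-module. Then the following two properties are equivalent (i) The
> graded Lie algebra `𝔤(𝔞, M)` has degrees `-2`, `0` and `2` only. (ii) …
> As we are interested in the graded Lie algebra's that so arise, we make the following definition. Say that a
> Lefschetz pair `(𝔤, h)` is a Jordan–Lefschetz pair if `(𝔤, h, 𝔤₂)` is a Lefschetz triple. …
> (2.2) Proposition. If `(𝔤, h)` is a Jordan–Lefschetz pair, then `𝔤 = 𝔤₋₂ ⊕ 𝔤₀ ⊕ 𝔤₂` …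
> (2.3) Corollary. Let `(𝔤, h)` be a Jordan–Lefschetz pair and let `M` be a finite dimensional representation of
> `𝔤` and regard `M` as a Lefschetz module of `𝔤₂`. Then `M` is generated as a `U𝔤₂`-module by `Prim(M)`."

## Contents (all proved)

* §1 Lefschetz triples: `lefschetzDuals_mono`, `lefschetzDomain_mono`;
  **`IsLefschetzTriple.isJordanLefschetzPair_of_adDegree_four_eq_bot`** (a Lefschetz triple `(𝔤, h, 𝔞)` with
  `𝔤₄ = 0` gives the Lefschetz triple `(𝔤, h, 𝔤₂)`: `[𝔤₂, 𝔤₂] ⊆ 𝔤₄ = 0`, `𝔞 ⊆ 𝔤₂`, generation is monotone),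
  `…_of_adDegree_eq_bot` ((2.1) (i) as printed), **`IsLefschetzTriple.isJordanLefschetzPair_iff`** (`⟺ 𝔤₄ = 0`,
  with A1-84's (2.2)).
* §2 Lefschetz modules: **`IsLefschetzModule.isJordanLefschetzPair`** (`𝔤(𝔞, M)₄ = 0 ⟹ (𝔤(𝔞, M), h)` is a
  Jordan–Lefschetz pair, via A1-101 `IsLefschetzModule.isLefschetzTriple`), `…_of_degrees` ((2.1) (i) as printed),
  `IsLefschetzModule.eq_zero_of_isJordanLefschetzPair` (then all degrees `∉ {-2, 0, 2}` of `𝔤(𝔞, M)` vanish),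
  `IsLefschetzModule.mem_primSubmodule_iff_of_isJordanLefschetzPair` (`Prim(M)` = joint kernel of `𝔤(𝔞, M)₋₂`), and
  **`IsLefschetzModule.eq_top_of_primSubmodule_le`**: (2.3) for Lefschetz modules of Jordan type — every subspace
  containing `Prim(M)` and stable under `𝔤(𝔞, M)₂` is `M` (A1-108 applied to the representation `M` of
  `(𝔤(𝔞, M), h)`); **`IsLefschetzModule.commute_of_mem_lefschetzDuals`** ((2.1) (i) ⟹ (ii) for Lefschetz modules:
  the `f_a` mutually commute).

## SCOPE (what is NOT formalised here)

(a) (2.1) (ii) ⟹ (i) (commuting `f_a` ⟹ degrees `-2, 0, 2` only) is not formalised (the printed proof needs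
repair; see the seat's notes).  (b) Nothing here concerns complex tori or the Hodge conjecture.

## References

* [LooijengaLunts1997] E. Looijenga, V. A. Lunts, *A Lie algebra attached to a projective variety*, Invent. Math. 129
  (1997) 361–412; arXiv:alg-geom/9604014. §2 (2.1)–(2.3), p. 9 L79–L83, L108–L125 of the held text; §1 (1.1) p. 4,
  (1.13) p. 7.
-/

namespace Literature.Algebra.Lie

open Module Function Set LieModule LieAlgebra

-- The commutator Lie ring of `𝔤𝔩(M) = Module.End K M`: Mathlib's reducible NON-instance, enabled file-locally
-- exactly as in `LefschetzModule.lean`.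
attribute [local instance 100] LieRing.ofAssociativeRing

section TripleJordan

variable {K : Type*} [Field K] [CharZero K] {L : Type*} [LieRing L] [LieAlgebra K L] {h : L} {𝔞 𝔟 : Submodule K L}

omit [CharZero K] in
/-- The image of `f` grows with `𝔞`. [cite: LooijengaLunts1997, §1 (1.1) p. 4 L17–L24] -/
theorem lefschetzDuals_mono (hle : 𝔞 ≤ 𝔟) : lefschetzDuals K h 𝔞 ⊆ lefschetzDuals K h 𝔟 :=
  fun _ ⟨e, he, t⟩ ↦ ⟨e, hle he, t⟩

omit [CharZero K] in
/-- The domain of `f` grows with `𝔞`. [cite: LooijengaLunts1997, §1 (1.1) p. 4 L17–L24] -/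
theorem lefschetzDomain_mono (hle : 𝔞 ≤ 𝔟) : lefschetzDomain K h 𝔞 ⊆ lefschetzDomain K h 𝔟 :=
  fun _ he ↦ ⟨hle he.1, he.2⟩

omit [CharZero K] in
/-- **"The graded Lie algebra's that so arise" are Jordan–Lefschetz**: a Lefschetz triple `(𝔤, h, 𝔞)` with
`𝔤₄ = 0` — in particular one whose `𝔤` "has degrees `-2`, `0` and `2` only" ((2.1) (i)) — makes `(𝔤, h)` a
Jordan–Lefschetz pair: `𝔤₂ ⊇ 𝔞` is abelian (`[𝔤₂, 𝔤₂] ⊆ 𝔤₄ = 0`), contains the Lefschetz elements of `𝔞`, and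
`𝔤₂ ∪ f(dom f) ⊇ 𝔞 ∪ f(dom f|_𝔞)` generates `𝔤`. [cite: LooijengaLunts1997, §2 (2.1)–(2.2) p. 9 L108–L110] -/
theorem IsLefschetzTriple.isJordanLefschetzPair_of_adDegree_four_eq_bot (T : IsLefschetzTriple K h 𝔞)
    (h4 : adDegree K h 4 = ⊥) : IsJordanLefschetzPair K h := by
  show IsLefschetzTriple K h (adDegree K h 2)
  exact
    { isSemisimple := T.isSemisimple
      le_adDegree_two := le_rfl
      lie_eq_zero := fun x hx y hy ↦ by
        have h1 := lie_mem_adDegree hx hy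
        rwa [show (2 : K) + 2 = 4 by norm_num, h4, Submodule.mem_bot] at h1
      nonempty_lefschetzDomain := by
        obtain ⟨e, he⟩ := T.nonempty_lefschetzDomain
        exact ⟨e, lefschetzDomain_mono T.le_adDegree_two he⟩
      lieSpan_eq_top := by
        rw [eq_top_iff, ← T.lieSpan_eq_top]
        exact LieSubalgebra.lieSpan_mono (Set.union_subset_union T.le_adDegree_two (lefschetzDuals_mono T.le_adDegree_two)) }

/-- (2.1) (i) as printed: a Lefschetz triple whose `𝔤` has degrees `-2`, `0`, `2` only is Jordan–Lefschetz.
[cite: LooijengaLunts1997, §2 (2.1)–(2.2) p. 9 L81–L83, L108–L110] -/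
theorem IsLefschetzTriple.isJordanLefschetzPair_of_adDegree_eq_bot (T : IsLefschetzTriple K h 𝔞)
    (hdeg : ∀ c : K, c ≠ -2 → c ≠ 0 → c ≠ 2 → adDegree K h c = ⊥) : IsJordanLefschetzPair K h :=
  T.isJordanLefschetzPair_of_adDegree_four_eq_bot (hdeg 4 (by norm_num) (by norm_num) (by norm_num))

/-- Conversely (A1-84 (2.2)): for a Jordan–Lefschetz pair `𝔤₄ = 0`; so a Lefschetz triple is Jordan–Lefschetz iff
`𝔤₄ = 0`. [cite: LooijengaLunts1997, §2 (2.2) p. 9 L112–L114] -/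
theorem IsLefschetzTriple.isJordanLefschetzPair_iff [FiniteDimensional K L] (T : IsLefschetzTriple K h 𝔞) :
    IsJordanLefschetzPair K h ↔ adDegree K h 4 = ⊥ :=
  ⟨fun J ↦ J.adDegree_eq_bot (by norm_num) (by norm_num) (by norm_num), T.isJordanLefschetzPair_of_adDegree_four_eq_bot⟩

end TripleJordan

/-! ## Lefschetz modules whose `𝔤(𝔞, M)` has degrees `-2, 0, 2` only -/

section ModuleJordan

variable {K : Type*} [Field K] [CharZero K] {M : Type*} [AddCommGroup M] [Module K M] [FiniteDimensional K M]
  {h : Module.End K M} {𝔞 : Submodule K (Module.End K M)}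

omit [FiniteDimensional K M] [CharZero K] in
/-- **A Lefschetz module `(𝔞, M)` satisfying (2.1) (i) gives a Jordan–Lefschetz pair `(𝔤(𝔞, M), h)`** — it suffices
that `𝔤(𝔞, M)₄ = 0`; with A1-101 §2 (`(𝔤(𝔞, M), h, 𝔞)` is a Lefschetz triple).
[cite: LooijengaLunts1997, §2 (2.1)–(2.2) p. 9 L81–L83, L108–L110] -/
theorem IsLefschetzModule.isJordanLefschetzPair (A : IsLefschetzModule K h 𝔞)
    (h4 : ∀ x ∈ lefschetzLieAlgebra K h 𝔞, ⁅h, x⁆ = (4 : K) • x → x = 0) :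
    IsJordanLefschetzPair K (⟨h, A.h_mem⟩ : lefschetzLieAlgebra K h 𝔞) := by
  refine A.isLefschetzTriple.isJordanLefschetzPair_of_adDegree_four_eq_bot ((Submodule.eq_bot_iff _).2 fun x hx ↦ ?_)
  exact Subtype.ext (h4 x x.2 (congrArg Subtype.val (mem_adDegree_iff.1 hx)))

omit [FiniteDimensional K M] in
/-- The same with (2.1) (i) as printed: "the graded Lie algebra `𝔤(𝔞, M)` has degrees `-2`, `0` and `2` only".
[cite: LooijengaLunts1997, §2 (2.1) p. 9 L81–L83] -/
theorem IsLefschetzModule.isJordanLefschetzPair_of_degrees (A : IsLefschetzModule K h 𝔞)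
    (hi : ∀ x ∈ lefschetzLieAlgebra K h 𝔞, ∀ c : K, c ≠ -2 → c ≠ 0 → c ≠ 2 → ⁅h, x⁆ = c • x → x = 0) :
    IsJordanLefschetzPair K (⟨h, A.h_mem⟩ : lefschetzLieAlgebra K h 𝔞) :=
  A.isJordanLefschetzPair fun x hx hx4 ↦ hi x hx 4 (by norm_num) (by norm_num) (by norm_num) hx4

/-- … and conversely, for such a Lefschetz module every other degree of `𝔤(𝔞, M)` vanishes (A1-84 (2.2)).
[cite: LooijengaLunts1997, §2 (2.2) p. 9 L112–L114] -/
theorem IsLefschetzModule.eq_zero_of_isJordanLefschetzPair (A : IsLefschetzModule K h 𝔞)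
    (J : IsJordanLefschetzPair K (⟨h, A.h_mem⟩ : lefschetzLieAlgebra K h 𝔞)) {x : Module.End K M}
    (hx : x ∈ lefschetzLieAlgebra K h 𝔞) {c : K} (hc₁ : c ≠ -2) (hc₂ : c ≠ 0) (hc₃ : c ≠ 2) (hxc : ⁅h, x⁆ = c • x) :
    x = 0 := by
  haveI : FiniteDimensional K (lefschetzLieAlgebra K h 𝔞) :=
    inferInstanceAs (FiniteDimensional K (lefschetzLieAlgebra K h 𝔞).toSubmodule)
  have h1 : (⟨x, hx⟩ : lefschetzLieAlgebra K h 𝔞) ∈ adDegree K (⟨h, A.h_mem⟩ : lefschetzLieAlgebra K h 𝔞) c :=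
    mem_adDegree_iff.2 (Subtype.ext hxc)
  rw [J.adDegree_eq_bot hc₁ hc₂ hc₃, Submodule.mem_bot] at h1
  exact congrArg Subtype.val h1

/-- For a Lefschetz module of Jordan type, `Prim(M)` (A1-102: killed by `𝔤(𝔞, M)_{<0}`) is the joint kernel of
`𝔤(𝔞, M)₋₂` — the other negative degrees vanish. [cite: LooijengaLunts1997, §1 (1.13) p. 7 L42–L44; §2 (2.2) p. 9 L112–L114] -/
theorem IsLefschetzModule.mem_primSubmodule_iff_of_isJordanLefschetzPair (A : IsLefschetzModule K h 𝔞)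
    (J : IsJordanLefschetzPair K (⟨h, A.h_mem⟩ : lefschetzLieAlgebra K h 𝔞)) {m : M} :
    m ∈ primSubmodule h 𝔞 ↔ ∀ x ∈ lefschetzLieAlgebra K h 𝔞, ⁅h, x⁆ = (-2 : K) • x → x m = 0 := by
  rw [mem_primSubmodule_iff]
  constructor
  · intro hm x hx hx2
    exact hm x hx 2 two_pos (mem_adDegree_iff.2 (by rw [hx2]; norm_num))
  · intro hm x hx n hn hxn
    by_cases h2 : (n : K) = 2
    · exact hm x hx (by rw [mem_adDegree_iff.1 hxn, h2])
    · have h3 : x = 0 := by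
        refine A.eq_zero_of_isJordanLefschetzPair J hx (c := -(n : K)) ?_ ?_ ?_ (mem_adDegree_iff.1 hxn)
        · exact fun h5 ↦ h2 (neg_inj.1 h5)
        · exact fun h5 ↦ hn.ne' (Nat.cast_eq_zero.1 (neg_eq_zero.1 h5))
        · intro h5
          have h8 : ((n + 2 : ℕ) : K) = 0 := by rw [Nat.cast_add, Nat.cast_two, ← h5, add_neg_cancel]
          exact absurd (Nat.cast_eq_zero.1 h8) (by omega)
      rw [h3, LinearMap.zero_apply]

/-- **(2.3) for Lefschetz modules of Jordan type: `M = U(𝔤(𝔞, M)₂) · Prim(M)`.**  For a Lefschetz module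
`(𝔞, M)` whose `𝔤(𝔞, M)` has degrees `-2, 0, 2` only (it suffices that `𝔤(𝔞, M)₄ = 0`), every subspace of `M`
containing `Prim(M)` (A1-102) and stable under `𝔤(𝔞, M)₂ ⊇ 𝔞` is all of `M` — LL (2.3) (A1-108) applied to the
representation `M` of the Jordan–Lefschetz pair `(𝔤(𝔞, M), h)`. [cite: LooijengaLunts1997, §2 (2.3) p. 9 L121–L125] -/
theorem IsLefschetzModule.eq_top_of_primSubmodule_le (A : IsLefschetzModule K h 𝔞)
    (h4 : ∀ x ∈ lefschetzLieAlgebra K h 𝔞, ⁅h, x⁆ = (4 : K) • x → x = 0) {N : Submodule K M}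
    (hP : primSubmodule h 𝔞 ≤ N)
    (hN : ∀ x ∈ lefschetzLieAlgebra K h 𝔞, ⁅h, x⁆ = (2 : K) • x → ∀ m ∈ N, x m ∈ N) : N = ⊤ := by
  haveI : FiniteDimensional K (lefschetzLieAlgebra K h 𝔞) :=
    inferInstanceAs (FiniteDimensional K (lefschetzLieAlgebra K h 𝔞).toSubmodule)
  have J := A.isJordanLefschetzPair h4
  refine J.eq_top_of_forall_mem_of_forall_lie_mem (M := M) (fun m hm ↦ hP ?_) ?_
  · rw [A.mem_primSubmodule_iff_of_isJordanLefschetzPair J]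
    intro x hx hx2
    exact hm ⟨x, hx⟩ (mem_adDegree_iff.2 (Subtype.ext hx2))
  · rintro ⟨x, hx⟩ hx2 m hm
    exact hN x hx (congrArg Subtype.val (mem_adDegree_iff.1 hx2)) m hm

/-- **(2.1) (i) ⟹ (ii) for Lefschetz modules: "The operators `f_a` with `a ∈ 𝔞` in the domain of `f`, mutually
commute"** when `𝔤(𝔞, M)` has degrees `-2, 0, 2` only (`𝔤(𝔞, M)₄ = 0` suffices): `[f_a, f_b] ∈ 𝔤(𝔞, M)₋₄ = 0`
(A1-84 (2.2) for the Jordan–Lefschetz pair `(𝔤(𝔞, M), h)`). [cite: LooijengaLunts1997, §2 (2.1) p. 9 L79–L85] -/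
theorem IsLefschetzModule.commute_of_mem_lefschetzDuals (A : IsLefschetzModule K h 𝔞)
    (h4 : ∀ x ∈ lefschetzLieAlgebra K h 𝔞, ⁅h, x⁆ = (4 : K) • x → x = 0) {f f' : Module.End K M}
    (hf : f ∈ lefschetzDuals K h 𝔞) (hf' : f' ∈ lefschetzDuals K h 𝔞) : f * f' = f' * f := by
  have J := A.isJordanLefschetzPair h4
  have h1 : ⁅f, f'⁆ ∈ adDegree K h ((-2 : K) + -2) :=
    lie_mem_adDegree (lefschetzDuals_subset_adDegree hf) (lefschetzDuals_subset_adDegree hf')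
  rw [show (-2 : K) + -2 = -4 by norm_num] at h1
  have h2 : ⁅f, f'⁆ = 0 :=
    A.eq_zero_of_isJordanLefschetzPair J
      ((lefschetzLieAlgebra K h 𝔞).lie_mem (lefschetzDuals_subset_lefschetzLieAlgebra hf)
        (lefschetzDuals_subset_lefschetzLieAlgebra hf'))
      (c := -4) (by norm_num) (by norm_num) (by norm_num) (mem_adDegree_iff.1 h1)
  rwa [Ring.lie_def, sub_eq_zero] at h2

end ModuleJordan

end Literature.Algebra.Lie
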